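import Summits.BirchSwinnertonDyer.BirchSwinnertonDyer.Theorems.SignedLowerHalvesSprungLowerDivisibilityAtThreeRankZeroBranch
import Summits.BirchSwinnertonDyer.BirchSwinnertonDyer.Theorems.SignedLowerHalvesSprungLowerHalfAtThreeSelmerNineRecordsA
import HarnessLib

/-!
# Route `SignedLowerHalves`, crux child K1 `SprungLowerDivisibilityAtThree` (item
# stmt-BirchSwinnertonDyer-19875) — RECORDS: Sprung's ♯/♭ Main Conjecture 1.3 / 7.21 AT TWO A8 CELLS,
# both colours, on the REAL `X^•(E/ℚ_∞)` (cell `bsd-ssimc`, seat `bsd-ssimc-k3-c5` g9, object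
# «K1-BRANCH» records; `--supports … --as helper`)

PARTITION (cell bsd-ssimc): X8 (A8) ∩ {r_an = 0} ∩ Surj(3) ∩ {#Ш_an = 9}, `p = 3` — the cells `2534f1`
and `4229a1` of the A8 window; witnesses (BC5-type) for the crux child K1 in Sprung's real currency;
closes NONE (the records CONSUME the cells' landed `BSD(E,3)` theorems `X8.bsdp3_sel9_<label>`, k3-c5 g5
p440213; 0 census moves by construction); BSD is not proved by any of this.

## What this file proves

* `X8.sprungSharpFlatMainConjecture_three_of_ainvs_of_selmerGroup_ne_bot_of_surj` — the RECORD SHAPE: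
  the per-pair theorem `K1Branch.sprungSharpFlatMainConjecture_of_bsdp` read off a literal model
  `⟨a₁,a₂,a₃,a₄,a₆⟩` through the `#Ш_an = 9` descent shape of k3-c5 g5
  (`X8.bsdp_three_rankZero_of_ainvs_of_selmerGroup_ne_bot_of_surj`, p439631): `3 ∤ Δ` and
  `#Ẽ(𝔽₃) ∈ {1, 7}` decided by the kernel give class X8; `ρ̄_{E,3}` onto is a landed certificate; the
  displayed per-pair data are `r_an = 0`, `#Ш_an = q` with `ord₃ q ≤ 2`, and `Sel^(3)(E/ℚ) ≠ ⊥`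
  (EVIDENCE: the landed two-engine exact `3`-descent rows, `Supersingular/X8DescentRecords.lean`, kit
  j091546); the named facts are the PUBLISHED ones of both files (Cassels–Tate, Wuthrich Prop. 21 and
  Lemma 20, GZK, modularity, Sprung 2012 Thms. 7.14 / 7.16, Sprung 2024 Lemmas 5.5–5.9 allN, the period
  unit at `3`).
* `X8.sprungMC3_sel9_2534f1`, `X8.sprungMC3_sel9_4229a1` — **Sprung's Main Conjecture 7.21
  `Theorems.SprungSharpFlatMainConjecture W 3 •` for `E = 2534f1` (`[1,-1,1,-303,-1955]`, `N = 2·7·181`,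
  `a₃ = 3`, `#Ш_an = 9`, `∏c_ℓ = 1`) and `E = 4229a1` (`[1,-1,1,-2091,-36272]`, `N = 4229` prime,
  `a₃ = 3`, `#Ш_an = 9`, `∏c_ℓ = 1`), EITHER colour** — to this seat's knowledge the first kernel
  inhabitants of Sprung's ♯/♭ main conjecture at `a_p ≠ 0` for actual curves with non-trivial `X^•`
  (`ord₃ gen(0) = 2`), modulo the displayed published facts and the cells' certified per-pair data.
  RECORDS; close nothing; K1 (class-level, all ranks) stays OPEN.

References: [Sprung2012] Thm. 7.14, Thm. 7.16, Main Conj. 1.3 / 7.21; [Sprung2024] §5.2 Lemmas 5.5–5.9;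
[Wuthrich2014] Lemma 20, Prop. 21; [Cremona2006] Table 1 (labels 2534f1, 4229a1); [Miller2011LMS]
Def. 1.1.
-/

set_option autoImplicit false
-- justification: the mandated namespace `Summit.BirchSwinnertonDyer.BirchSwinnertonDyer.Theorems`
-- (single-conjunct summit, Sub = Summit) repeats a segment by design (D-0017).
set_option linter.dupNamespace false

noncomputable section

namespace Summit.BirchSwinnertonDyer.BirchSwinnertonDyer.Theorems.K1Branch

open scoped Classical
open WeierstrassCurve Literature.NumberTheory.EllipticCurves
  Literature.NumberTheory.EllipticCurves.Rank1Residual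
  Literature.NumberTheory.EllipticCurves.Rank1Residual.Typed
  Literature.NumberTheory.EllipticCurves.Rank1Residual.X11RankOneCertificates
  Literature.NumberTheory.EllipticCurves.Sprung2017 Literature.NumberTheory.EllipticCurves.Sprung2012
  Literature.NumberTheory.EllipticCurves.Sprung2024
  Literature.NumberTheory.EllipticCurves.Wuthrich2014
  Summit.BirchSwinnertonDyer.BirchSwinnertonDyer.Rank1Residual.IntModel
  Summit.BirchSwinnertonDyer.BirchSwinnertonDyer.Rank1Residual.X11RankOne
  Summit.BirchSwinnertonDyer.Rank1Residual.X11b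
  Summit.BirchSwinnertonDyer.Rank1Residual.Supersingular
  Summit.BirchSwinnertonDyer.BirchSwinnertonDyer.Theorems

/-- **RECORD SHAPE: Sprung's ♯/♭ Main Conjecture 7.21 at `p = 3`, either colour, read off a literal
model through the `#Ш_an = 9` descent shape.** For `W = ⟨a₁,a₂,a₃,a₄,a₆⟩` elliptic and globally
minimal (`hE`, `hmin`: `Δ ≠ 0` and a bounded Kraus certificate at the call site), `3 ∤ Δ`, `#Ẽ(𝔽₃) = n₃ ∈
{1, 7}` (so class X8: good supersingular at `3`, `a₃ = ±3`), `ρ̄_{E,3}` onto (`hsurj`, a landed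
certificate), `r_an = 0`, `#Ш_an = q` with `ord₃ q ≤ 2`, `Sel^(3)(E/ℚ) ≠ ⊥`: `BSD(E,3)` holds
(`X8.bsdp_three_rankZero_of_ainvs_of_selmerGroup_ne_bot_of_surj`, k3-c5 g5) and hence, by
`K1Branch.sprungSharpFlatMainConjecture_of_bsdp`, Sprung's Main Conjecture on the REAL `X^•(E/ℚ_∞)`.
Named facts: PUBLISHED (`hCT`, `hW`, `hL20`, `hGZK`, `hmod`, `h714`, `h716`, `h59` = child K3, `h3`).
PER PAIR; closes nothing. [cite: Sprung2012, Thm. 7.14, Thm. 7.16 and Main Conj. 7.21 (pp. 1504–1505)]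
[cite: Sprung2024, §5.2 Lemmas 5.5–5.9 (pp. 40–41)] [cite: Wuthrich2014, Lemma 20 (p. 399) and Prop. 21 (p. 400)]
[cite: SilvermanAEC2009, Thm. X.4.14 and VII.1 Remark 1.1] [cite: Miller2011LMS, Def. 1.1] -/
theorem X8.sprungSharpFlatMainConjecture_three_of_ainvs_of_selmerGroup_ne_bot_of_surj
    (h714 : thm714_sharpFlatSelmerDual_finite_torsion)
    (h716 : thm716_sharpFlatCharIdeal_divisibility)
    (h59 : lem59AllN_sharpFlatCharValue_rankZero)
    (h3 : realPeriodRat_eq_unit_mul_plusPeriod_three)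
    (hL20 : Wuthrich2014.lemma20_surjective_threeAdic_of_semistable)
    (hCT : exists_casselsTate_pairing (K := ℚ)) (hW : sha_dvd_analyticSha)
    (hGZK : rank_eq_analyticRank_of_analyticRank_le_one) (hmod : hasEntireLFunction_rat)
    (a1 a2 a3 a4 a6 : ℤ) (hE : (⟨a1, a2, a3, a4, a6⟩ : WeierstrassCurve ℚ).IsElliptic)
    (hmin : (⟨a1, a2, a3, a4, a6⟩ : WeierstrassCurve ℚ).IsGloballyMinimal)
    (h3Δ : ¬ (3 : ℤ) ∣ discOf [a1, a2, a3, a4, a6]) {n₃ : ℕ}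
    (hc₃ : countPoints [a1, a2, a3, a4, a6] 3 = n₃) (hn17 : n₃ = 1 ∨ n₃ = 7)
    (hsurj : Surj (⟨a1, a2, a3, a4, a6⟩ : WeierstrassCurve ℚ) 3)
    (hr : (⟨a1, a2, a3, a4, a6⟩ : WeierstrassCurve ℚ).analyticRank = 0)
    {q : ℚ} (hq : shaAn (⟨a1, a2, a3, a4, a6⟩ : WeierstrassCurve ℚ) = (q : ℂ))
    (hv : padicValRat 3 q ≤ 2)
    (hSel : (⟨a1, a2, a3, a4, a6⟩ : WeierstrassCurve ℚ).selmerGroup (3 : ℤ) ≠ ⊥) (col : Chroma) :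
    SprungSharpFlatMainConjecture (⟨a1, a2, a3, a4, a6⟩ : WeierstrassCurve ℚ) 3 col := by
  have hI : integralModelInt (⟨a1, a2, a3, a4, a6⟩ : WeierstrassCurve ℚ) = ⟨a1, a2, a3, a4, a6⟩ :=
    integralModelInt_eq_of_map_eq _ (map_mk_int a1 a2 a3 a4 a6)
  -- class X8 at `3` from `3 ∤ Δ` and the point count `#Ẽ(𝔽₃) ∈ {1, 7}`
  have hX : ClassX8 (⟨a1, a2, a3, a4, a6⟩ : WeierstrassCurve ℚ) 3 :=
    classX8_of_intModel hI (by rw [intCurve_Δ]; exact h3Δ)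
      (natCard_point_eq_of_countPoints a1 a2 a3 a4 a6 3 (by decide) h3Δ hc₃) hn17
  -- the cell's `BSD(E,3)` for the pair (k3-c5 g5 shape)
  have hB : BSDp (⟨a1, a2, a3, a4, a6⟩ : WeierstrassCurve ℚ) 3 :=
    X8.bsdp_three_rankZero_of_ainvs_of_selmerGroup_ne_bot_of_surj hCT hW hGZK hmod a1 a2 a3 a4 a6 hmin
      h3Δ hc₃ hn17 hsurj hr hq hv hSel
  exact sprungSharpFlatMainConjecture_of_bsdp h714 h716 h59 h3 hL20 hGZK hmod _ 3 hX hsurj hr hB col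

/-- **Sprung's ♯/♭ Main Conjecture 7.21 for `2534f1` at `p = 3`, EITHER colour** — X8 ∩ {r_an = 0} ∩
{surj(3)}, `#Ш_an = 9`; Cremona model `[1,-1,1,-303,-1955]`, `N = 2534 = 2·7·181`, good supersingular
at `3` with `a₃ = 3`, `ρ̄_{E,3}` onto (`surj_x8r0_2534f1_3`), `#E(ℚ)_tors = 1`, `∏ c_ℓ = 1` — so
`char_Λ X^•(E/ℚ_∞) = (ϖ · L^•_3(E))` for `• ∈ {♯, ♭}` with `L^• ≠ 0`, on the REAL dual data, with
`ord₃ gen(0) = 2` (non-trivial `X^•`). Kernel-decided: global minimality (bounded Kraus certificate), `3 ∤ Δ`, `#Ẽ(𝔽₃) = 1`. Displayed per pair: `hr`, `hq`/`hv` (`#Ш_an = 9`), `hSel : Sel^(3)(E/ℚ) ≠ ⊥` (EVIDENCE: the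
landed exact `3`-descent row of `2534f1`, `Supersingular/X8DescentRecords.lean`, kit j091546). Named
facts: PUBLISHED. RECORD; closes nothing. [cite: Sprung2012, Main Conj. 1.3 (p. 1486) and Main Conj. 7.21 (p. 1505)]
[cite: Sprung2024, §5.2 Lemmas 5.5–5.9 (pp. 40–41)] [cite: Wuthrich2014, Prop. 21 (p. 400)]
[cite: Cremona2006, Table 1 (Cremona label 2534f1)] -/
theorem X8.sprungMC3_sel9_2534f1
    (h714 : thm714_sharpFlatSelmerDual_finite_torsion)
    (h716 : thm716_sharpFlatCharIdeal_divisibility)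
    (h59 : lem59AllN_sharpFlatCharValue_rankZero)
    (h3 : realPeriodRat_eq_unit_mul_plusPeriod_three)
    (hL20 : Wuthrich2014.lemma20_surjective_threeAdic_of_semistable)
    (hCT : exists_casselsTate_pairing (K := ℚ)) (hW : sha_dvd_analyticSha)
    (hGZK : rank_eq_analyticRank_of_analyticRank_le_one) (hmod : hasEntireLFunction_rat)
    (W : WeierstrassCurve ℚ) [W.IsElliptic] [W.IsGloballyMinimal]
    (hWm : W = ⟨1, -1, 1, -303, -1955⟩) (hr : W.analyticRank = 0)
    {q : ℚ} (hq : shaAn W = (q : ℂ)) (hv : padicValRat 3 q ≤ 2) (hSel : W.selmerGroup (3 : ℤ) ≠ ⊥)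
    (col : Chroma) : SprungSharpFlatMainConjecture W 3 col := by
  subst hWm
  exact X8.sprungSharpFlatMainConjecture_three_of_ainvs_of_selmerGroup_ne_bot_of_surj h714 h716 h59 h3
    hL20 hCT hW hGZK hmod 1 (-1) 1 (-303) (-1955)
    (isElliptic_of_discOf_ne_zero 1 (-1) 1 (-303) (-1955) (by decide))
    (isGloballyMinimal_of_krausCriterion_bounded 1 (-1) 1 (-303) (-1955)
      (by decide +kernel) (by decide +kernel) (by decide +kernel))
    (by decide) (n₃ := 1) (by decide +kernel) (by decide) surj_x8r0_2534f1_3 hr hq hv hSel col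

/-- **Sprung's ♯/♭ Main Conjecture 7.21 for `4229a1` at `p = 3`, EITHER colour** — X8 ∩ {r_an = 0} ∩
{surj(3)}, `#Ш_an = 9`; Cremona model `[1,-1,1,-2091,-36272]`, `N = 4229` (prime), good supersingular
at `3` with `a₃ = 3`, `ρ̄_{E,3}` onto (`surj_x8r0_4229a1_3`), `#E(ℚ)_tors = 1`, `∏ c_ℓ = 1`.
Kernel-decided: global minimality (bounded Kraus certificate), `3 ∤ Δ`, `#Ẽ(𝔽₃) = 1`. Displayed per pair: `hr`, `hq`/`hv`
(`#Ш_an = 9`), `hSel` (EVIDENCE: the landed exact `3`-descent row of `4229a1`, kit j091546). Named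
facts: PUBLISHED. RECORD; closes nothing. [cite: Sprung2012, Main Conj. 1.3 (p. 1486) and Main Conj. 7.21 (p. 1505)]
[cite: Sprung2024, §5.2 Lemmas 5.5–5.9 (pp. 40–41)] [cite: Wuthrich2014, Prop. 21 (p. 400)]
[cite: Cremona2006, Table 1 (Cremona label 4229a1)] -/
theorem X8.sprungMC3_sel9_4229a1
    (h714 : thm714_sharpFlatSelmerDual_finite_torsion)
    (h716 : thm716_sharpFlatCharIdeal_divisibility)
    (h59 : lem59AllN_sharpFlatCharValue_rankZero)
    (h3 : realPeriodRat_eq_unit_mul_plusPeriod_three)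
    (hL20 : Wuthrich2014.lemma20_surjective_threeAdic_of_semistable)
    (hCT : exists_casselsTate_pairing (K := ℚ)) (hW : sha_dvd_analyticSha)
    (hGZK : rank_eq_analyticRank_of_analyticRank_le_one) (hmod : hasEntireLFunction_rat)
    (W : WeierstrassCurve ℚ) [W.IsElliptic] [W.IsGloballyMinimal]
    (hWm : W = ⟨1, -1, 1, -2091, -36272⟩) (hr : W.analyticRank = 0)
    {q : ℚ} (hq : shaAn W = (q : ℂ)) (hv : padicValRat 3 q ≤ 2) (hSel : W.selmerGroup (3 : ℤ) ≠ ⊥)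
    (col : Chroma) : SprungSharpFlatMainConjecture W 3 col := by
  subst hWm
  exact X8.sprungSharpFlatMainConjecture_three_of_ainvs_of_selmerGroup_ne_bot_of_surj h714 h716 h59 h3
    hL20 hCT hW hGZK hmod 1 (-1) 1 (-2091) (-36272)
    (isElliptic_of_discOf_ne_zero 1 (-1) 1 (-2091) (-36272) (by decide))
    (isGloballyMinimal_of_krausCriterion_bounded 1 (-1) 1 (-2091) (-36272)
      (by decide +kernel) (by decide +kernel) (by decide +kernel))
    (by decide) (n₃ := 1) (by decide +kernel) (by decide) surj_x8r0_4229a1_3 hr hq hv hSel col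

end Summit.BirchSwinnertonDyer.BirchSwinnertonDyer.Theorems.K1Branch

end
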